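import Mathlib

/-!
# `NoHeavyLowerTail` (stmt-CriticalPhenomena-4575) — the `λ = 2` two-level cone of the `E₃` fibre cubic is inherited by
# sub-segments (de Casteljau / blossom), hence by common-module substitutions; the affine-in-the-bottom form of `M⁺`

Support file of the P2 lane (Sahi's algebraic route), seat `prim-masterthm-p2` gen 15, `--supports stmt-CriticalPhenomena-4575`.
Pure algebra over `ℝ` (`ring` identities, termwise sign bookkeeping); no definitions, no named facts, no sorries.  Companion of
`…SahiE3TwoLevel` (Bernstein coefficients `β₀..β₃` of `p ↦ E₃` along one coordinate; two-level forms `M⁻ = 3β₁ − β₀`,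
`M⁺ = 3β₂ − β₃`), `…SahiChordGap` (chord gap) and the refutation `…SahiChordSuperlinearRefuted` (`¬ ChordSuperlinear 5`).

SETTING.  Along a coordinate `e` of weight `t` the Sahi functional of a triple of up-sets under a product measure is a cubic
`E(t) = β₀(1−t)³ + 3β₁t(1−t)² + 3β₂t²(1−t) + β₃t³`, `β₀ = E₃(0-sections)`, `β₃ = E₃(1-sections)`.  The `λ = 2` RUNG at `e`
(bnk-2's `SahiTwoLevelMinus/Plus`, master-conj's BGC, ttrl's MC1/MC2) is membership of `(β₀,β₁,β₂,β₃)` in the simplicial cone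
  `K = {β₀ ≥ 0, β₃ ≥ 0, 3β₁ ≥ β₀, 3β₂ ≥ β₃} = cone{(1−t)², t(1−t)², t²(1−t), t²}`,
which forces all four Bernstein coefficients `≥ 0` and `E ≥ 0` on `[0,1]` (`cone_nonneg`).

COMMON MODULES (why sub-segments matter).  If the three events factor through one monotone Boolean `g(x_B)` of a block `B ∋ e`
(`U_i(x) = V_i(g(x_B), x_rest)` — a common module), then under a product measure the two sections of `U` at `e` have exactly the
joint moments of `V` at the macro-biases `π₀ = P(g = 1 | x_e = 0) ≤ π₁ = P(g = 1 | x_e = 1)`; since `M^±, β₀, β₃` involve only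
same-level joint moments, the fibre cubic of `U` at `e` is the fibre cubic `φ` of `V` at the macro-coordinate RESTRICTED to
`[π₀, π₁] ⊆ [0,1]`.  So a property of fibre cubics inherited by sub-segments passes from the quotient `V` to `U` (and a minimal
violator of it is module-free), while a property NOT inherited by sub-segments can be destroyed by `x ↦ x ∨ x′`.  This file:

* `restrict_right_bernstein`, `restrict_left_bernstein`, `restrict_bernstein` — de Casteljau / blossom coefficients of the
  restricted cubic (`ring`);
* `cone_restrict_right`, `cone_restrict_left`, **`cone_restrict`** — `K` is inherited by every sub-segment `[a,b] ⊆ [0,1]`, with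
  the explicit termwise-nonnegative certificates (in the cone coordinates `u = (β₀, 3β₁−β₀, 3β₂−β₃, β₃)`)
  `3F(a,a,b) − F(a,a,a) = 2(1−a)(1−b)u₀ + (1−a)[2a(1−b)+(b−a)(1−a)]u₁ + a[2a(1−b)+(b−a)(2−a)]u₂ + 2ab·u₃`,
  `3F(a,b,b) − F(b,b,b) = 2(1−a)(1−b)u₀ + (1−b)[(b−a)(1+b)+2a(1−b)]u₁ + b[(b−a)b+2a(1−b)]u₂ + 2ab·u₃`;
* `below_subchord_example` — by contrast "`E` lies above its chord at the point `t`" (the per-coordinate criterion FBP of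
  prim-l12-p5 = `(B∃)` of P2 gen 14) is NOT inherited: the cone cubic `E = t(1−t)²` (`β = (0,1/3,0,0)`) lies above its `[0,1]`-chord
  (which is `0`) everywhere, but on the sub-segment `[1/2, 1]` it is convex and lies strictly BELOW the sub-chord at `t = 3/4`.  This is
  the cubic mechanism behind `SahiChordSuperlinear.not_chordSuperlinear_five`, whose witness (the star-`α` triple with every variable
  doubled, `q ≡ 2/3`) is a common-module substitution into a chord-positive 3-coin triple;
* `M_plus_affine_form`, `M_minus_affine_form` — the two-level forms written so that `M⁺` is visibly AFFINE in the level-`0` (bottom)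
  data and `M⁻` in the level-`1` (top) data: with `e, aᵢ, bᵢ` the triple/single/pair moments at the two levels,
  `M⁺ = (2e¹ − a₁¹a₂¹a₃¹) + 2e⁰ − Σᵢ aᵢ¹bᵢ⁰ − Σᵢ (bᵢ¹ − aⱼ¹aₖ¹)aᵢ⁰`, i.e. for nested up-sets `Hᵢ ⊆ Gᵢ`
  `M⁺(H;G) = 2μ(H₁H₂H₃) − Σᵢ μ(Gᵢ)μ(HⱼHₖ) − Σᵢ Cov(Gⱼ,Gₖ)μ(Hᵢ) + 2μ(G₁G₂G₃) − μ(G₁)μ(G₂)μ(G₃)`;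
  at `H = G` this is `2E₃(G)`, at `H = (∅, G₂, G₃)` it is `E₃(G)`: PLUS interpolates Kahn's `C₃` linearly in the bottom triple.

CONSEQUENCES recorded in P2's SAHI-ROUTE §4.39 (paper, not formalised here): BGC-all / the `λ = 2` rung cannot fail first on a
triple with a common module (a minimal violator is module-free; compositions of triples on `≤ 5` macro-coordinates, where the rung is
certified for all `p`, never violate it), whereas `(B∃)` and its `p_e`-free strengthening CORE-AXIS-CONVEX are false already on the
structural core (doubled star-`α`, all six coordinates essential, `B_e < 0 ∀e` at `q ≡ 2/3`, `Q_e < 0 ∀e` at `q ≡ 1/2`), with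
`M⁺ = 2ε⁷(1−ε²)² > 0`, `β₀ = ε⁶ + O(ε⁷)` at `q = 1−ε` (the rung is ratio-tight, `3β₁/β₀ → 1`, but not crossed).
[cite: Sahi2008, Conj. 5]; [cite: LiebSahi2021, Def. 3.1].
-/

namespace Summit.CriticalPhenomena.PercolationContinuityZ3.Theorems

namespace SahiTwoLevelSubsegment

/-- **de Casteljau, right segment.**  The cubic with Bernstein coefficients `(β₀,β₁,β₂,β₃)` restricted to `[s,1]`
(`u ↦ s + (1−s)u`) has Bernstein coefficients `(E(s), (1−s)²β₁ + 2s(1−s)β₂ + s²β₃, (1−s)β₂ + sβ₃, β₃)`.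
[folklore: de Casteljau subdivision] -/
theorem restrict_right_bernstein (β₀ β₁ β₂ β₃ s u : ℝ) :
    let E : ℝ → ℝ := fun t => β₀ * (1 - t) ^ 3 + 3 * β₁ * t * (1 - t) ^ 2 + 3 * β₂ * t ^ 2 * (1 - t) + β₃ * t ^ 3
    E (s + (1 - s) * u) =
      E s * (1 - u) ^ 3 + 3 * ((1 - s) ^ 2 * β₁ + 2 * s * (1 - s) * β₂ + s ^ 2 * β₃) * u * (1 - u) ^ 2
        + 3 * ((1 - s) * β₂ + s * β₃) * u ^ 2 * (1 - u) + β₃ * u ^ 3 := by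
  intro E
  simp only [E]
  ring

/-- **de Casteljau, left segment.**  The cubic restricted to `[0,s]` (`u ↦ su`) has Bernstein coefficients
`(β₀, (1−s)β₀ + sβ₁, (1−s)²β₀ + 2s(1−s)β₁ + s²β₂, E(s))`. [folklore: de Casteljau subdivision] -/
theorem restrict_left_bernstein (β₀ β₁ β₂ β₃ s u : ℝ) :
    let E : ℝ → ℝ := fun t => β₀ * (1 - t) ^ 3 + 3 * β₁ * t * (1 - t) ^ 2 + 3 * β₂ * t ^ 2 * (1 - t) + β₃ * t ^ 3
    E (s * u) =
      β₀ * (1 - u) ^ 3 + 3 * ((1 - s) * β₀ + s * β₁) * u * (1 - u) ^ 2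
        + 3 * ((1 - s) ^ 2 * β₀ + 2 * s * (1 - s) * β₁ + s ^ 2 * β₂) * u ^ 2 * (1 - u) + E s * u ^ 3 := by
  intro E
  simp only [E]
  ring

/-- **Blossom form of a general restriction.**  With the polar form
`F(x,y,z) = β₀(1−x)(1−y)(1−z) + β₁[x(1−y)(1−z)+…] + β₂[xy(1−z)+…] + β₃xyz` of the cubic, the restriction to `[a,b]`
(`u ↦ a + (b−a)u`) has Bernstein coefficients `(F(a,a,a), F(a,a,b), F(a,b,b), F(b,b,b))`. [folklore: polar forms / blossoming] -/
theorem restrict_bernstein (β₀ β₁ β₂ β₃ a b u : ℝ) :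
    let E : ℝ → ℝ := fun t => β₀ * (1 - t) ^ 3 + 3 * β₁ * t * (1 - t) ^ 2 + 3 * β₂ * t ^ 2 * (1 - t) + β₃ * t ^ 3
    let F : ℝ → ℝ → ℝ → ℝ := fun x y z =>
      β₀ * (1 - x) * (1 - y) * (1 - z)
        + β₁ * (x * (1 - y) * (1 - z) + (1 - x) * y * (1 - z) + (1 - x) * (1 - y) * z)
        + β₂ * (x * y * (1 - z) + x * (1 - y) * z + (1 - x) * y * z) + β₃ * x * y * z
    E (a + (b - a) * u) =
      F a a a * (1 - u) ^ 3 + 3 * F a a b * u * (1 - u) ^ 2 + 3 * F a b b * u ^ 2 * (1 - u) + F b b b * u ^ 3 := by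
  intro E F
  simp only [E, F]
  ring

/-- A cubic whose Bernstein data lie in the `λ = 2` cone is nonnegative on `[0,1]` (all four coefficients are `≥ 0`).
[this file] -/
theorem cone_nonneg {β₀ β₁ β₂ β₃ s : ℝ} (h0 : 0 ≤ β₀) (h3 : 0 ≤ β₃) (hm : β₀ ≤ 3 * β₁) (hp : β₃ ≤ 3 * β₂)
    (hs0 : 0 ≤ s) (hs1 : s ≤ 1) :
    0 ≤ β₀ * (1 - s) ^ 3 + 3 * β₁ * s * (1 - s) ^ 2 + 3 * β₂ * s ^ 2 * (1 - s) + β₃ * s ^ 3 := by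
  have h1s : 0 ≤ 1 - s := by linarith
  have hb1 : 0 ≤ 3 * β₁ := by linarith
  have hb2 : 0 ≤ 3 * β₂ := by linarith
  have e1 : 0 ≤ β₀ * (1 - s) ^ 3 := by positivity
  have e2 : 0 ≤ 3 * β₁ * s * (1 - s) ^ 2 := by positivity
  have e3 : 0 ≤ 3 * β₂ * s ^ 2 * (1 - s) := by positivity
  have e4 : 0 ≤ β₃ * s ^ 3 := by positivity
  linarith

/-- **The `λ = 2` cone is inherited by right sub-segments `[s,1]`** (coefficients of `restrict_right_bernstein`).
Certificates: `3β₂' − β₃' = (1−s)(3β₂ − β₃) + 2sβ₃`, `3β₁' − β₀' = (1−s)³(3β₁ − β₀) + 3s(1−s)(2−s)β₂ + s²(3−s)β₃`.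
[this file] -/
theorem cone_restrict_right {β₀ β₁ β₂ β₃ s : ℝ} (h0 : 0 ≤ β₀) (h3 : 0 ≤ β₃) (hm : β₀ ≤ 3 * β₁)
    (hp : β₃ ≤ 3 * β₂) (hs0 : 0 ≤ s) (hs1 : s ≤ 1) :
    let β₀' := β₀ * (1 - s) ^ 3 + 3 * β₁ * s * (1 - s) ^ 2 + 3 * β₂ * s ^ 2 * (1 - s) + β₃ * s ^ 3
    let β₁' := (1 - s) ^ 2 * β₁ + 2 * s * (1 - s) * β₂ + s ^ 2 * β₃
    let β₂' := (1 - s) * β₂ + s * β₃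
    let β₃' := β₃
    0 ≤ β₀' ∧ 0 ≤ β₃' ∧ β₀' ≤ 3 * β₁' ∧ β₃' ≤ 3 * β₂' := by
  intro β₀' β₁' β₂' β₃'
  have h1s : 0 ≤ 1 - s := by linarith
  have hb2 : 0 ≤ β₂ := by linarith
  refine ⟨cone_nonneg h0 h3 hm hp hs0 hs1, h3, ?_, ?_⟩
  · have hid : 3 * β₁' - β₀' =
        (1 - s) ^ 3 * (3 * β₁ - β₀) + 3 * s * (1 - s) * (2 - s) * β₂ + s ^ 2 * (3 - s) * β₃ := by
      simp only [β₀', β₁']; ring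
    have t1 : 0 ≤ (1 - s) ^ 3 * (3 * β₁ - β₀) := mul_nonneg (by positivity) (by linarith)
    have t2 : 0 ≤ 3 * s * (1 - s) * (2 - s) * β₂ :=
      mul_nonneg (mul_nonneg (by positivity) (by linarith)) hb2
    have t3 : 0 ≤ s ^ 2 * (3 - s) * β₃ := mul_nonneg (mul_nonneg (by positivity) (by linarith)) h3
    linarith
  · have hid : 3 * β₂' - β₃' = (1 - s) * (3 * β₂ - β₃) + 2 * s * β₃ := by
      simp only [β₂', β₃']; ring
    have t1 : 0 ≤ (1 - s) * (3 * β₂ - β₃) := mul_nonneg h1s (by linarith)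
    have t2 : 0 ≤ 2 * s * β₃ := by positivity
    linarith

/-- **The `λ = 2` cone is inherited by left sub-segments `[0,s]`** (coefficients of `restrict_left_bernstein`).
Certificates: `3β₁' − β₀' = s(3β₁ − β₀) + 2(1−s)β₀`, `3β₂' − β₃' = (1−s)²(2+s)β₀ + 3s(1−s)(1+s)β₁ + s³(3β₂ − β₃)`.
[this file] -/
theorem cone_restrict_left {β₀ β₁ β₂ β₃ s : ℝ} (h0 : 0 ≤ β₀) (h3 : 0 ≤ β₃) (hm : β₀ ≤ 3 * β₁)
    (hp : β₃ ≤ 3 * β₂) (hs0 : 0 ≤ s) (hs1 : s ≤ 1) :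
    let β₀' := β₀
    let β₁' := (1 - s) * β₀ + s * β₁
    let β₂' := (1 - s) ^ 2 * β₀ + 2 * s * (1 - s) * β₁ + s ^ 2 * β₂
    let β₃' := β₀ * (1 - s) ^ 3 + 3 * β₁ * s * (1 - s) ^ 2 + 3 * β₂ * s ^ 2 * (1 - s) + β₃ * s ^ 3
    0 ≤ β₀' ∧ 0 ≤ β₃' ∧ β₀' ≤ 3 * β₁' ∧ β₃' ≤ 3 * β₂' := by
  intro β₀' β₁' β₂' β₃'
  have h1s : 0 ≤ 1 - s := by linarith
  have hb1 : 0 ≤ β₁ := by linarith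
  refine ⟨h0, cone_nonneg h0 h3 hm hp hs0 hs1, ?_, ?_⟩
  · have hid : 3 * β₁' - β₀' = s * (3 * β₁ - β₀) + 2 * (1 - s) * β₀ := by
      simp only [β₀', β₁']; ring
    have t1 : 0 ≤ s * (3 * β₁ - β₀) := mul_nonneg hs0 (by linarith)
    have t2 : 0 ≤ 2 * (1 - s) * β₀ := by positivity
    linarith
  · have hid : 3 * β₂' - β₃' =
        (1 - s) ^ 2 * (2 + s) * β₀ + 3 * s * (1 - s) * (1 + s) * β₁ + s ^ 3 * (3 * β₂ - β₃) := by
      simp only [β₂', β₃']; ring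
    have t1 : 0 ≤ (1 - s) ^ 2 * (2 + s) * β₀ := by positivity
    have t2 : 0 ≤ 3 * s * (1 - s) * (1 + s) * β₁ := by positivity
    have t3 : 0 ≤ s ^ 3 * (3 * β₂ - β₃) := mul_nonneg (by positivity) (by linarith)
    linarith

/-- **The `λ = 2` cone is inherited by every sub-segment `[a,b] ⊆ [0,1]`** (blossom form, coefficients of
`restrict_bernstein`): if `(β₀,β₁,β₂,β₃) ∈ K` then `(F(a,a,a), F(a,a,b), F(a,b,b), F(b,b,b)) ∈ K`.  Certificates in the cone
coordinates `u = (β₀, 3β₁−β₀, 3β₂−β₃, β₃) ≥ 0`: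
`3F(a,a,b) − F(a,a,a) = 2(1−a)(1−b)u₀ + (1−a)[2a(1−b)+(b−a)(1−a)]u₁ + a[2a(1−b)+(b−a)(2−a)]u₂ + 2ab·u₃`,
`3F(a,b,b) − F(b,b,b) = 2(1−a)(1−b)u₀ + (1−b)[(b−a)(1+b)+2a(1−b)]u₁ + b[(b−a)b+2a(1−b)]u₂ + 2ab·u₃`. [this file] -/
theorem cone_restrict {β₀ β₁ β₂ β₃ a b : ℝ} (h0 : 0 ≤ β₀) (h3 : 0 ≤ β₃) (hm : β₀ ≤ 3 * β₁)
    (hp : β₃ ≤ 3 * β₂) (ha : 0 ≤ a) (hab : a ≤ b) (hb : b ≤ 1) :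
    let F : ℝ → ℝ → ℝ → ℝ := fun x y z =>
      β₀ * (1 - x) * (1 - y) * (1 - z)
        + β₁ * (x * (1 - y) * (1 - z) + (1 - x) * y * (1 - z) + (1 - x) * (1 - y) * z)
        + β₂ * (x * y * (1 - z) + x * (1 - y) * z + (1 - x) * y * z) + β₃ * x * y * z
    0 ≤ F a a a ∧ 0 ≤ F b b b ∧ F a a a ≤ 3 * F a a b ∧ F b b b ≤ 3 * F a b b := by
  intro F
  have hb0 : 0 ≤ b := le_trans ha hab
  have ha1 : a ≤ 1 := le_trans hab hb
  have h1a : 0 ≤ 1 - a := by linarith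
  have h1b : 0 ≤ 1 - b := by linarith
  have hba : 0 ≤ b - a := by linarith
  have hu1 : 0 ≤ 3 * β₁ - β₀ := by linarith
  have hu2 : 0 ≤ 3 * β₂ - β₃ := by linarith
  have hFa : F a a a =
      β₀ * (1 - a) ^ 3 + 3 * β₁ * a * (1 - a) ^ 2 + 3 * β₂ * a ^ 2 * (1 - a) + β₃ * a ^ 3 := by
    simp only [F]; ring
  have hFb : F b b b =
      β₀ * (1 - b) ^ 3 + 3 * β₁ * b * (1 - b) ^ 2 + 3 * β₂ * b ^ 2 * (1 - b) + β₃ * b ^ 3 := by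
    simp only [F]; ring
  refine ⟨?_, ?_, ?_, ?_⟩
  · rw [hFa]; exact cone_nonneg h0 h3 hm hp ha ha1
  · rw [hFb]; exact cone_nonneg h0 h3 hm hp hb0 hb
  · have hid : 3 * F a a b - F a a a =
        2 * (1 - a) * (1 - b) * β₀ + (1 - a) * (2 * a * (1 - b) + (b - a) * (1 - a)) * (3 * β₁ - β₀)
          + a * (2 * a * (1 - b) + (b - a) * (2 - a)) * (3 * β₂ - β₃) + 2 * a * b * β₃ := by
      simp only [F]; ring
    have t1 : 0 ≤ 2 * (1 - a) * (1 - b) * β₀ := by positivity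
    have t2 : 0 ≤ (1 - a) * (2 * a * (1 - b) + (b - a) * (1 - a)) * (3 * β₁ - β₀) :=
      mul_nonneg (mul_nonneg h1a (by positivity)) hu1
    have t3 : 0 ≤ a * (2 * a * (1 - b) + (b - a) * (2 - a)) * (3 * β₂ - β₃) :=
      mul_nonneg (mul_nonneg ha (add_nonneg (by positivity) (mul_nonneg hba (by linarith)))) hu2
    have t4 : 0 ≤ 2 * a * b * β₃ := by positivity
    linarith
  · have hid : 3 * F a b b - F b b b =
        2 * (1 - a) * (1 - b) * β₀ + (1 - b) * ((b - a) * (1 + b) + 2 * a * (1 - b)) * (3 * β₁ - β₀)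
          + b * ((b - a) * b + 2 * a * (1 - b)) * (3 * β₂ - β₃) + 2 * a * b * β₃ := by
      simp only [F]; ring
    have t1 : 0 ≤ 2 * (1 - a) * (1 - b) * β₀ := by positivity
    have t2 : 0 ≤ (1 - b) * ((b - a) * (1 + b) + 2 * a * (1 - b)) * (3 * β₁ - β₀) :=
      mul_nonneg (mul_nonneg h1b (by positivity)) hu1
    have t3 : 0 ≤ b * ((b - a) * b + 2 * a * (1 - b)) * (3 * β₂ - β₃) :=
      mul_nonneg (mul_nonneg hb0 (by positivity)) hu2
    have t4 : 0 ≤ 2 * a * b * β₃ := by positivity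
    linarith

/-- **Chord positivity at a point is NOT inherited by sub-segments** (the cubic mechanism behind
`SahiChordSuperlinear.not_chordSuperlinear_five`).  The cone cubic `E(t) = t(1−t)²` (`β = (0, 1/3, 0, 0) ∈ K`) has zero chord on
`[0,1]` and `E ≥ 0` there, but on `[1/2, 1]` (where it is convex) it lies strictly below its sub-chord: at `t = 3/4`,
`E(3/4) = 3/64 < (E(1/2) + E(1))/2 = 1/16`. [this file] -/
theorem below_subchord_example :
    let E : ℝ → ℝ := fun t => t * (1 - t) ^ 2
    (∀ t, 0 ≤ t → t ≤ 1 → (1 - t) * E 0 + t * E 1 ≤ E t) ∧ E (3 / 4) < (E (1 / 2) + E 1) / 2 := by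
  intro E
  refine ⟨fun t ht0 ht1 => ?_, ?_⟩
  · simp only [E]
    nlinarith [mul_nonneg ht0 (pow_two_nonneg (1 - t))]
  · simp only [E]
    norm_num

/-- **`M⁺` is affine in the bottom (level-`0`) data.**  In the fourteen two-level moments of `…SahiE3TwoLevel`
(`e = E[fgh]`, `aᵢ = E[fᵢ]`, `b₁ = E[gh]`, `b₂ = E[fh]`, `b₃ = E[fg]`, second index = level), the form `3β₂ − β₃` equals
`(2e¹ − a₁¹a₂¹a₃¹) + 2e⁰ − Σᵢ aᵢ¹bᵢ⁰ − Σᵢ (bᵢ¹ − aⱼ¹aₖ¹)·aᵢ⁰` — every monomial carries at most one level-`0` factor.  For nested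
up-sets `Hᵢ ⊆ Gᵢ`: `M⁺ = 2μ(H₁H₂H₃) − Σᵢ μ(Gᵢ)μ(HⱼHₖ) − Σᵢ Cov(Gⱼ,Gₖ)μ(Hᵢ) + 2μ(G₁G₂G₃) − μ(G₁)μ(G₂)μ(G₃)`. [this file] -/
theorem M_plus_affine_form {R : Type*} [CommRing R]
    (e₀ e₁ a₁₀ a₁₁ a₂₀ a₂₁ a₃₀ a₃₁ b₁₀ b₁₁ b₂₀ b₂₁ b₃₀ b₃₁ : R) :
    let β₃ := 2 * e₁ - (a₁₁ * b₁₁ + a₂₁ * b₂₁ + a₃₁ * b₃₁) + a₁₁ * a₂₁ * a₃₁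
    let β₂3 := 4 * e₁ + 2 * e₀
        - ((a₁₁ * b₁₁ + a₁₁ * b₁₀ + a₁₀ * b₁₁) + (a₂₁ * b₂₁ + a₂₁ * b₂₀ + a₂₀ * b₂₁)
            + (a₃₁ * b₃₁ + a₃₁ * b₃₀ + a₃₀ * b₃₁))
        + (a₁₀ * a₂₁ * a₃₁ + a₁₁ * a₂₀ * a₃₁ + a₁₁ * a₂₁ * a₃₀)
    β₂3 - β₃ =
      (2 * e₁ - a₁₁ * a₂₁ * a₃₁) + 2 * e₀ - (a₁₁ * b₁₀ + a₂₁ * b₂₀ + a₃₁ * b₃₀)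
        - ((b₁₁ - a₂₁ * a₃₁) * a₁₀ + (b₂₁ - a₁₁ * a₃₁) * a₂₀ + (b₃₁ - a₁₁ * a₂₁) * a₃₀) := by
  intro β₃ β₂3
  simp only [β₃, β₂3]
  ring

/-- **`M⁻` is affine in the top (level-`1`) data** (the same identity with the levels exchanged):
`3β₁ − β₀ = (2e⁰ − a₁⁰a₂⁰a₃⁰) + 2e¹ − Σᵢ aᵢ⁰bᵢ¹ − Σᵢ (bᵢ⁰ − aⱼ⁰aₖ⁰)·aᵢ¹`, i.e. for nested up-sets `Hᵢ ⊆ Gᵢ`: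
`M⁻ = 2μ(G₁G₂G₃) − Σᵢ μ(Hᵢ)μ(GⱼGₖ) − Σᵢ Cov(Hⱼ,Hₖ)μ(Gᵢ) + 2μ(H₁H₂H₃) − μ(H₁)μ(H₂)μ(H₃)`. [this file] -/
theorem M_minus_affine_form {R : Type*} [CommRing R]
    (e₀ e₁ a₁₀ a₁₁ a₂₀ a₂₁ a₃₀ a₃₁ b₁₀ b₁₁ b₂₀ b₂₁ b₃₀ b₃₁ : R) :
    let β₀ := 2 * e₀ - (a₁₀ * b₁₀ + a₂₀ * b₂₀ + a₃₀ * b₃₀) + a₁₀ * a₂₀ * a₃₀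
    let β₁3 := 4 * e₀ + 2 * e₁
        - ((a₁₀ * b₁₀ + a₁₀ * b₁₁ + a₁₁ * b₁₀) + (a₂₀ * b₂₀ + a₂₀ * b₂₁ + a₂₁ * b₂₀)
            + (a₃₀ * b₃₀ + a₃₀ * b₃₁ + a₃₁ * b₃₀))
        + (a₁₁ * a₂₀ * a₃₀ + a₁₀ * a₂₁ * a₃₀ + a₁₀ * a₂₀ * a₃₁)
    β₁3 - β₀ =
      (2 * e₀ - a₁₀ * a₂₀ * a₃₀) + 2 * e₁ - (a₁₀ * b₁₁ + a₂₀ * b₂₁ + a₃₀ * b₃₁)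
        - ((b₁₀ - a₂₀ * a₃₀) * a₁₁ + (b₂₀ - a₁₀ * a₃₀) * a₂₁ + (b₃₀ - a₁₀ * a₂₀) * a₃₁) := by
  intro β₀ β₁3
  simp only [β₀, β₁3]
  ring

end SahiTwoLevelSubsegment

end Summit.CriticalPhenomena.PercolationContinuityZ3.Theorems
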